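import Literature.Analysis.FluidPDE.DicedHardSphereDynamics
import Literature.Analysis.FluidPDE.CollisionCylinder
import HarnessLib

/-!
# Lambert's lift pushes the uniform disc law forward to the cosine (flux) law of the hemisphere

Helper file of the stub `stub_kickMatchedStationaryCore` (W2) of the crux line `stein-lindeberg-kick-swap`
(crux `InformationPercolationEngine.PercolationClosesChaos`, stmt-AtomisticToContinuum-13914): the ONE fact about
`Lambert.lift` (`Literature.Analysis.FluidPDE.DicedHardSphereDynamics`) that the rejection sampler `kmNormal` of the
kick-matched gas `Z*` relies on and that the tree did not have — **Archimedes' hat-box theorem in flux form**: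
for a unit vector `a ∈ ℝ³`, the lift `q ↦ Lambert.lift a q` of the open unit disc of `ℝ²` onto the hemisphere about
`a` pushes Lebesgue measure forward to the cosine-weighted surface measure `⟪a, ν⟫₊ dσ(ν)` (the Knudsen / flux law,
unnormalised; total mass `π`).

* `Lambert.lift_coords` — `lift a (coords a ν) = ν` on the closed hemisphere `⟪a, ν⟫ ≥ 0` of the unit sphere;
* `measurePreserving_coordsInner` — `x ↦ (coords a x, ⟪a, x⟫)` is a measure-preserving map `ℝ³ → ℝ² × ℝ`;
* `lintegral_toSphere_cos_comp_coords` — **the flux form of the hat-box theorem**: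
  `∫ ⟪a, ν⟫₊ f (coords a ν) dσ(ν) = ∫_{‖p‖ < 1} f p dp` for measurable `f ≥ 0` on `ℝ²`;
* `map_lift_volume_ball` — equivalently `(Leb|_{B(0,1)}) ∘ (lift a)⁻¹ = (⟪a, ·⟫₊ σ)` pushed to `ℝ³`;
* `lintegral_toSphere_cos` — the total flux `∫ ⟪a, ν⟫₊ dσ(ν) = |B_{ℝ²}(0, 1)| = π`.

Proof: the collision-cylinder formula `lintegral_collisionCylinder` (`dx = ⟪a, ν⟫ dσ(ν) dτ` on
`{ν + τ a | ⟪a, ν⟫ > 0, τ > 0}`, radius `1`, axis `a`) applied to `g(x) = f(coords a x) 1_{(0,1]}(⟪a, x⟫ − √(1 − ‖coords a x‖²))`,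
whose cylinder-coordinate form is `f(coords a ν) 1_{(0,1]}(τ)` and whose Lebesgue integral is `∫_{B(0,1)} f` by Fubini
in the orthonormal frame `(e₁ a, e₂ a, a)`.

References: Archimedes, *On the Sphere and Cylinder* I (the hat-box theorem); F. Comets, S. Popov, G. M. Schütz,
M. Vachkovskaia, ARMA 191 (2008) §2.2 (the cosine reflection law `γ_d ⟪e, u⟫ du` and its simulation by lifting a
uniform point of the disc). [CometsEtAl2008]
-/

noncomputable section

open scoped BigOperators ENNReal Topology InnerProductSpace
open MeasureTheory Set Filter Metric

namespace Literature.Analysis.FluidPDE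

local notation "E²" => EuclideanSpace ℝ (Fin 2)
local notation "E³" => EuclideanSpace ℝ (Fin 3)

namespace Lambert

variable {a : E³}

/-- `coords a` forgets translations along `a`: `coords a (x + τ a) = coords a x`. [folklore] -/
theorem coords_add_smul_self (a : E³) (x : E³) (τ : ℝ) : coords a (x + τ • a) = coords a x := by
  rw [coords_add, coords_smul, coords_self, smul_zero, add_zero]

/-- On the unit sphere, `‖coords a ν‖² = 1 − ⟪a, ν⟫²` (unit `a`). [folklore] -/
theorem norm_sq_coords_of_norm_eq_one (ha : ‖a‖ = 1) {ν : E³} (hν : ‖ν‖ = 1) :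
    ‖coords a ν‖ ^ 2 = 1 - ⟪a, ν⟫_ℝ ^ 2 := by
  rw [norm_sq_coords ha, hν, one_pow]

/-- On the closed hemisphere `⟪a, ν⟫ ≥ 0` of the unit sphere, `√(1 − ‖coords a ν‖²) = ⟪a, ν⟫`. [folklore] -/
theorem sqrt_one_sub_norm_sq_coords (ha : ‖a‖ = 1) {ν : E³} (hν : ‖ν‖ = 1) (h0 : 0 ≤ ⟪a, ν⟫_ℝ) :
    √(1 - ‖coords a ν‖ ^ 2) = ⟪a, ν⟫_ℝ := by
  rw [norm_sq_coords_of_norm_eq_one ha hν, sub_sub_cancel, Real.sqrt_sq h0]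

/-- On the open hemisphere `⟪a, ν⟫ > 0` of the unit sphere the Lambert coordinates lie in the open unit disc.
[folklore] -/
theorem norm_coords_lt_one (ha : ‖a‖ = 1) {ν : E³} (hν : ‖ν‖ = 1) (h0 : 0 < ⟪a, ν⟫_ℝ) :
    ‖coords a ν‖ < 1 := by
  have h := norm_sq_coords_of_norm_eq_one ha hν
  have h2 : ‖coords a ν‖ ^ 2 < 1 ^ 2 := by rw [h, one_pow]; nlinarith
  exact lt_of_pow_lt_pow_left₀ 2 zero_le_one h2

/-- **`lift a` inverts `coords a` on the closed hemisphere about `a`**: for a unit vector `ν` with `⟪a, ν⟫ ≥ 0`,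
`lift a (coords a ν) = ν` (unit `a`). [folklore] -/
theorem lift_coords (ha : ‖a‖ = 1) {ν : E³} (hν : ‖ν‖ = 1) (h0 : 0 ≤ ⟪a, ν⟫_ℝ) :
    lift a (coords a ν) = ν := by
  rw [lift, sqrt_one_sub_norm_sq_coords ha hν h0, embed_coords ha]
  abel

/-- `coords a` is continuous. [folklore] -/
theorem continuous_coords (a : E³) : Continuous (coords a) := by
  have h : Continuous fun x : E³ => (WithLp.toLp 2 ![⟪e₁ a, x⟫_ℝ, ⟪e₂ a, x⟫_ℝ] : E²) := by
    refine (PiLp.continuous_toLp 2 _).comp ?_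
    refine continuous_pi fun i => ?_
    fin_cases i
    · exact (continuous_const.inner continuous_id : Continuous fun x : E³ => ⟪e₁ a, x⟫_ℝ)
    · exact (continuous_const.inner continuous_id : Continuous fun x : E³ => ⟪e₂ a, x⟫_ℝ)
  exact h

/-- `coords a` is measurable. [folklore] -/
theorem measurable_coords (a : E³) : Measurable (coords a) :=
  (continuous_coords a).measurable

/-- `lift a` is continuous. [folklore] -/
theorem continuous_lift (a : E³) : Continuous (lift a) := by
  unfold lift embed
  fun_prop

/-- `lift a` is measurable. [folklore] -/
theorem measurable_lift (a : E³) : Measurable (lift a) :=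
  (continuous_lift a).measurable

end Lambert

/-! ## The frame map `x ↦ (coords a x, ⟪a, x⟫)` is measure preserving -/

/-- **The orthonormal frame `(e₁ a, e₂ a, a)` splits Lebesgue measure**: `x ↦ (coords a x, ⟪a, x⟫)` is a
measure-preserving map `ℝ³ → ℝ² × ℝ` (unit `a`; composition of the isometry `frameBasis.repr`, `ofLp`,
`piFinSuccAbove 2`, a swap and `toLp`). [folklore] -/
theorem measurePreserving_coordsInner {a : E³} (ha : ‖a‖ = 1) :
    MeasurePreserving (fun x : E³ => (Lambert.coords a x, ⟪a, x⟫_ℝ))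
      (volume : Measure E³) (volume : Measure (E² × ℝ)) := by
  have h1 : MeasurePreserving ((Lambert.frameBasis ha).repr : E³ → EuclideanSpace ℝ (Fin 3)) volume volume :=
    (Lambert.frameBasis ha).repr.measurePreserving
  have h2 : MeasurePreserving (@WithLp.ofLp 2 (Fin 3 → ℝ)) volume volume := PiLp.volume_preserving_ofLp (Fin 3)
  have h3 : MeasurePreserving (MeasurableEquiv.piFinSuccAbove (fun _ : Fin 3 => ℝ) 2) volume volume :=
    volume_preserving_piFinSuccAbove (fun _ : Fin 3 => ℝ) 2
  have h4 : MeasurePreserving (Prod.swap : ℝ × (Fin 2 → ℝ) → (Fin 2 → ℝ) × ℝ) volume volume :=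
    Measure.measurePreserving_swap
  have h5 : MeasurePreserving (Prod.map (@WithLp.toLp 2 (Fin 2 → ℝ)) (id : ℝ → ℝ)) volume volume :=
    (PiLp.volume_preserving_toLp (Fin 2)).prod (MeasurePreserving.id volume)
  have h := h5.comp (h4.comp (h3.comp (h2.comp h1)))
  convert h using 1
  funext x
  have hr : ∀ i, (Lambert.frameBasis ha).repr x i = ⟪Lambert.frame a i, x⟫_ℝ := fun i => by
    rw [OrthonormalBasis.repr_apply_apply, Lambert.coe_frameBasis]
  refine Prod.ext ?_ ?_
  · simp only [Function.comp_apply, Prod.map_fst, Prod.fst_swap, MeasurableEquiv.piFinSuccAbove_apply]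
    ext i
    fin_cases i
    · simp [Lambert.coords, hr, Lambert.frame, Fin.removeNth, Fin.succAbove]
    · simp [Lambert.coords, hr, Lambert.frame, Fin.removeNth, Fin.succAbove, Fin.lt_def]
  · simp only [Function.comp_apply, Prod.map_snd, Prod.snd_swap, MeasurableEquiv.piFinSuccAbove_apply, id]
    change ⟪a, x⟫_ℝ = ((Lambert.frameBasis ha).repr x).ofLp 2
    rw [hr]
    simp [Lambert.frame]

/-- **Fubini in the frame of `a`**: `∫ F (coords a x, ⟪a, x⟫) dx = ∫ dp ∫ dt F (p, t)` for measurable `F ≥ 0`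
(unit `a`). [folklore] -/
theorem lintegral_comp_coordsInner {a : E³} (ha : ‖a‖ = 1) {F : E² × ℝ → ℝ≥0∞} (hF : Measurable F) :
    ∫⁻ x : E³, F (Lambert.coords a x, ⟪a, x⟫_ℝ) = ∫⁻ p : E², ∫⁻ t : ℝ, F (p, t) := by
  rw [(measurePreserving_coordsInner ha).lintegral_comp hF, Measure.volume_eq_prod,
    lintegral_prod _ hF.aemeasurable]

/-! ## The hat-box theorem in flux form -/

/-- **Archimedes' hat-box theorem, flux form / the cosine law is the lifted uniform disc law**: for a unit vector
`a` of `ℝ³` and measurable `f ≥ 0` on `ℝ²`,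
`∫_{S²} ⟪a, ν⟫₊ f (coords a ν) dσ(ν) = ∫_{‖p‖ < 1} f (p) dp`
(`σ = volume.toSphere`, the surface measure; `ENNReal.ofReal ⟪a, ν⟫` is the positive part). Proof: the
collision-cylinder formula `lintegral_collisionCylinder` at radius `1` and axis `a` for
`g x = f (coords a x) · 1_{(0,1]}(⟪a, x⟫ − √(1 − ‖coords a x‖²))`. [cite: CometsEtAl2008, §2.2] -/
theorem lintegral_toSphere_cos_comp_coords {a : E³} (ha : ‖a‖ = 1) {f : E² → ℝ≥0∞} (hf : Measurable f) :
    ∫⁻ ν : sphere (0 : E³) 1, ENNReal.ofReal ⟪a, (ν : E³)⟫_ℝ * f (Lambert.coords a ν) ∂(volume.toSphere) =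
      ∫⁻ p in ball (0 : E²) 1, f p := by
  classical
  -- the test function in the frame coordinates and in the bulk
  set F : E² × ℝ → ℝ≥0∞ := fun q =>
    (ball (0 : E²) 1).indicator f q.1 * (Ioc (0 : ℝ) 1).indicator 1 (q.2 - √(1 - ‖q.1‖ ^ 2)) with hFdef
  have hFm : Measurable F := by
    refine ((hf.indicator measurableSet_ball).comp measurable_fst).mul ?_
    refine (measurable_one.indicator measurableSet_Ioc).comp ?_
    exact measurable_snd.sub (measurable_fst.norm.pow_const 2 |>.const_sub 1 |>.sqrt)
  set g : E³ → ℝ≥0∞ := fun x => F (Lambert.coords a x, ⟪a, x⟫_ℝ) with hgdef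
  have hgm : Measurable g :=
    hFm.comp ((Lambert.measurable_coords a).prodMk (measurable_const.inner measurable_id))
  have hcyl := lintegral_collisionCylinder (volume : Measure E³) one_pos a g hgm
  -- the unit interval has length one, wherever it sits
  have hIoc : ∀ s : ℝ, ∫⁻ t : ℝ, (Ioc (0 : ℝ) 1).indicator (1 : ℝ → ℝ≥0∞) (t - s) = 1 := fun s => by
    have h := lintegral_add_right_eq_self (μ := (volume : Measure ℝ))
      (fun t => (Ioc (0 : ℝ) 1).indicator (1 : ℝ → ℝ≥0∞) t) (-s)
    simp only [← sub_eq_add_neg] at h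
    rw [h, lintegral_indicator_one measurableSet_Ioc, Real.volume_Ioc, sub_zero, ENNReal.ofReal_one]
  -- the bulk side: `g` lives on the collision cylinder, and its integral is `∫_{B(0,1)} f` by Fubini
  have hsupp : Function.support g ⊆ collisionCylRegion 1 a := by
    intro x hx
    rw [Function.mem_support, hgdef] at hx
    simp only [hFdef] at hx
    have h1 : (ball (0 : E²) 1).indicator f (Lambert.coords a x) ≠ 0 := left_ne_zero_of_mul hx
    have h2 : (Ioc (0 : ℝ) 1).indicator (1 : ℝ → ℝ≥0∞)
        (⟪a, x⟫_ℝ - √(1 - ‖Lambert.coords a x‖ ^ 2)) ≠ 0 := right_ne_zero_of_mul hx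
    have hp : ‖Lambert.coords a x‖ < 1 := by
      have := Set.mem_of_indicator_ne_zero h1
      rwa [mem_ball_zero_iff] at this
    have ht : √(1 - ‖Lambert.coords a x‖ ^ 2) < ⟪a, x⟫_ℝ := by
      have := Set.mem_of_indicator_ne_zero h2
      exact sub_pos.1 this.1
    set p := Lambert.coords a x with hpdef
    set s := √(1 - ‖p‖ ^ 2) with hsdef
    have hs0 : 0 < s := Real.sqrt_pos.2 (by nlinarith [norm_nonneg p])
    have hts : 0 < ⟪a, x⟫_ℝ - s := sub_pos.2 ht
    have hlift1 : ‖Lambert.lift a p‖ = 1 := Lambert.norm_lift ha hp.le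
    have hlifta : ⟪a, Lambert.lift a p⟫_ℝ = s := by rw [real_inner_comm, Lambert.inner_lift_self ha]
    refine ⟨(⟪a, x⟫_ℝ - s) • Lambert.lift a p, ?_, ?_⟩
    · show 0 < ⟪a, (⟪a, x⟫_ℝ - s) • Lambert.lift a p⟫_ℝ
      rw [inner_smul_right, hlifta]
      exact mul_pos hts hs0
    · have hn : ‖(⟪a, x⟫_ℝ - s) • Lambert.lift a p‖ = ⟪a, x⟫_ℝ - s := by
        rw [norm_smul, hlift1, mul_one, Real.norm_of_nonneg hts.le]
      rw [collisionCylMap, hn, smul_smul, one_div, inv_mul_cancel₀ hts.ne', one_smul, Lambert.lift,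
        hpdef, Lambert.embed_coords ha, ← hpdef, ← hsdef]
      rw [sub_smul]
      abel
  have hbulk : ∫⁻ r in collisionCylRegion 1 a, g r = ∫⁻ p in ball (0 : E²) 1, f p := by
    rw [setLIntegral_eq_of_support_subset hsupp, hgdef, lintegral_comp_coordsInner ha hFm]
    simp only [hFdef]
    have hin : ∀ p : E², ∫⁻ t : ℝ, (ball (0 : E²) 1).indicator f p *
        (Ioc (0 : ℝ) 1).indicator 1 (t - √(1 - ‖p‖ ^ 2)) = (ball (0 : E²) 1).indicator f p := fun p => by
      have hm : Measurable (fun t : ℝ => (Ioc (0 : ℝ) 1).indicator (1 : ℝ → ℝ≥0∞) (t - √(1 - ‖p‖ ^ 2))) :=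
        (measurable_one.indicator measurableSet_Ioc).comp (measurable_id.sub_const _)
      rw [lintegral_const_mul _ hm, hIoc, mul_one]
    simp_rw [hin]
    rw [lintegral_indicator measurableSet_ball]
  -- the sphere side: in cylinder coordinates `g (ν + τ a) = f (coords a ν) 1_{(0,1]}(τ)`
  have hsph : ∫⁻ ν : sphere (0 : E³) 1, ∫⁻ τ in Ioi (0 : ℝ),
      (collisionCylDom a).indicator (fun _ => (1 : ℝ≥0∞)) (ν : E³) *
        (ENNReal.ofReal ((1 : ℝ) ^ (Module.finrank ℝ E³ - 1) * ⟪a, (ν : E³)⟫_ℝ) *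
          g ((1 : ℝ) • (ν : E³) + τ • a)) ∂volume ∂volume.toSphere =
      ∫⁻ ν : sphere (0 : E³) 1, ENNReal.ofReal ⟪a, (ν : E³)⟫_ℝ * f (Lambert.coords a ν) ∂volume.toSphere := by
    refine lintegral_congr fun ν => ?_
    have hν : ‖(ν : E³)‖ = 1 := by simp
    by_cases hmem : (ν : E³) ∈ collisionCylDom a
    · have hpos : 0 < ⟪a, (ν : E³)⟫_ℝ := hmem
      have hp : ‖Lambert.coords a ν‖ < 1 := Lambert.norm_coords_lt_one ha hν hpos
      have hs : √(1 - ‖Lambert.coords a ν‖ ^ 2) = ⟪a, (ν : E³)⟫_ℝ :=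
        Lambert.sqrt_one_sub_norm_sq_coords ha hν hpos.le
      have hgv : ∀ τ : ℝ, g ((1 : ℝ) • (ν : E³) + τ • a) =
          f (Lambert.coords a ν) * (Ioc (0 : ℝ) 1).indicator 1 τ := fun τ => by
        simp only [hgdef, hFdef, one_smul, Lambert.coords_add_smul_self, inner_add_right, inner_smul_right,
          real_inner_self_eq_norm_sq, ha, one_pow, mul_one, hs, add_sub_cancel_left,
          indicator_of_mem (mem_ball_zero_iff.2 hp)]
      simp only [indicator_of_mem hmem, one_pow, one_mul, hgv, ← mul_assoc]
      have hm : Measurable fun τ : ℝ => (Ioc (0 : ℝ) 1).indicator (1 : ℝ → ℝ≥0∞) τ :=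
        measurable_one.indicator measurableSet_Ioc
      rw [lintegral_const_mul _ hm]
      have hI : ∫⁻ τ in Ioi (0 : ℝ), (Ioc (0 : ℝ) 1).indicator (1 : ℝ → ℝ≥0∞) τ = 1 := by
        rw [lintegral_indicator_one measurableSet_Ioc, Measure.restrict_apply measurableSet_Ioc,
          inter_eq_left.2 Ioc_subset_Ioi_self, Real.volume_Ioc, sub_zero, ENNReal.ofReal_one]
      rw [hI, mul_one]
    · have hle : ⟪a, (ν : E³)⟫_ℝ ≤ 0 := not_lt.1 hmem
      simp only [indicator_of_notMem hmem, zero_mul, lintegral_zero, ENNReal.ofReal_eq_zero.2 hle]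
  rw [← hsph, ← hcyl, hbulk]

/-- **The lifted uniform disc law is the cosine law**, as an identity of measures on `ℝ³`: for unit `a`,
`Leb|_{B(0,1)} ∘ (lift a)⁻¹ = ι_* (⟪a, ·⟫₊ σ)` (`ι` the inclusion of the unit sphere). [cite: CometsEtAl2008, §2.2] -/
theorem map_lift_volume_ball {a : E³} (ha : ‖a‖ = 1) :
    (volume.restrict (ball (0 : E²) 1)).map (Lambert.lift a) =
      ((volume.toSphere.withDensity fun ν : sphere (0 : E³) 1 => ENNReal.ofReal ⟪a, (ν : E³)⟫_ℝ).map
        ((↑) : sphere (0 : E³) 1 → E³)) := by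
  ext s hs
  rw [Measure.map_apply (Lambert.measurable_lift a) hs, Measure.map_apply measurable_subtype_coe hs,
    withDensity_apply _ (measurable_subtype_coe hs), ← lintegral_indicator (measurable_subtype_coe hs),
    Measure.restrict_apply (Lambert.measurable_lift a hs)]
  have hf : Measurable fun p : E² => s.indicator (1 : E³ → ℝ≥0∞) (Lambert.lift a p) :=
    (measurable_one.indicator hs).comp (Lambert.measurable_lift a)
  have key := lintegral_toSphere_cos_comp_coords ha hf
  have hpt : ∀ ν : sphere (0 : E³) 1,
      (((↑) : sphere (0 : E³) 1 → E³) ⁻¹' s).indicator (fun ν => ENNReal.ofReal ⟪a, (ν : E³)⟫_ℝ) ν =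
        ENNReal.ofReal ⟪a, (ν : E³)⟫_ℝ * s.indicator (1 : E³ → ℝ≥0∞) (Lambert.lift a (Lambert.coords a ν)) := by
    intro ν
    have hν : ‖(ν : E³)‖ = 1 := by simp
    rcases le_or_gt ⟪a, (ν : E³)⟫_ℝ 0 with hle | hpos
    · have h0 : ENNReal.ofReal ⟪a, (ν : E³)⟫_ℝ = 0 := ENNReal.ofReal_eq_zero.2 hle
      rw [h0, zero_mul]
      by_cases hmem : ν ∈ ((↑) : sphere (0 : E³) 1 → E³) ⁻¹' s
      · rw [indicator_of_mem hmem, h0]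
      · rw [indicator_of_notMem hmem]
    · rw [Lambert.lift_coords ha hν hpos.le]
      by_cases hmem : (ν : E³) ∈ s
      · rw [indicator_of_mem (show ν ∈ ((↑) : sphere (0 : E³) 1 → E³) ⁻¹' s from hmem), indicator_of_mem hmem,
          Pi.one_apply, mul_one]
      · rw [indicator_of_notMem (show ν ∉ ((↑) : sphere (0 : E³) 1 → E³) ⁻¹' s from hmem),
          indicator_of_notMem hmem, mul_zero]
  simp_rw [hpt]
  rw [key]
  have hind : (fun p : E² => s.indicator (1 : E³ → ℝ≥0∞) (Lambert.lift a p)) = (Lambert.lift a ⁻¹' s).indicator 1 := by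
    funext p
    by_cases hp : Lambert.lift a p ∈ s
    · rw [indicator_of_mem hp, indicator_of_mem (show p ∈ Lambert.lift a ⁻¹' s from hp)]
      rfl
    · rw [indicator_of_notMem hp, indicator_of_notMem (show p ∉ Lambert.lift a ⁻¹' s from hp)]
  rw [hind, lintegral_indicator_one ((Lambert.measurable_lift a) hs),
    Measure.restrict_apply ((Lambert.measurable_lift a) hs)]

/-- **Total flux through the hemisphere**: `∫_{S²} ⟪a, ν⟫₊ dσ(ν) = |B_{ℝ²}(0,1)| = π` (unit `a`). [folklore] -/
theorem lintegral_toSphere_cos {a : E³} (ha : ‖a‖ = 1) :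
    ∫⁻ ν : sphere (0 : E³) 1, ENNReal.ofReal ⟪a, (ν : E³)⟫_ℝ ∂(volume.toSphere) = ENNReal.ofReal Real.pi := by
  have h := lintegral_toSphere_cos_comp_coords ha (f := fun _ => 1) measurable_const
  simp only [mul_one, lintegral_const, Measure.restrict_apply MeasurableSet.univ, univ_inter, one_mul] at h
  rw [h, EuclideanSpace.volume_ball_fin_two, ENNReal.ofReal_one, one_pow, one_mul]

end Literature.Analysis.FluidPDE

end
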